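import Literature.Analysis.FluidPDE.Tao2016AveragedNS.SplitCascadeRescaledChannels
import Literature.Analysis.FluidPDE.Tao2016AveragedNS.SplitCascadeRescaledModes
import Literature.Analysis.FluidPDE.Tao2016AveragedNS.SplitCascadeRescaledWindow
import Literature.Analysis.FluidPDE.TaoCascadeRescaledBootstrap
import Literature.Analysis.FluidPDE.TaoCascadeScaleOnePast
import HarnessLib

/-!
# The split Prop. 6.5: the asymmetry-window certificate from the profile and the bootstrap regime

T. Tao, *Finite time blowup for an averaged three-dimensional Navier–Stokes equation*,
J. Amer. Math. Soc. 29 (2016), 601–674 = arXiv:1402.0290v3, §6.5 ((6.92)–(6.95), the bootstrap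
regime `GoodAt`) and §5.5 / Theorem 5.3 (the asymmetry channels); Grönwall's inequality
[`HairerNorsettWanner1993`, §I.10].
HONEST FRAMING: statements about the SPLIT cascade model system; nothing here proves the split
Prop. 6.5 and nothing here concerns the true Navier–Stokes equations.

WHAT THIS FILE SUPPLIES. The ported §6.5–6.7 bootstrap (`SplitCascadeZeroScale*.lean`,
`SplitCascadeScaleOne*.lean`) reads every mode equation through a window certificate
`AsymWindow ε₀ K ε C₁ n₀ W T ζ` (`SplitCascadeRescaledWindow.lean`): `|Z̃_{i,k}(t)| ≤ ζ` for the three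
live scales `k ∈ {-1,0,1}` on `[0, T]`. Here the pointwise half of that certificate is DERIVED from
(a) the profile at the checkpoint, `|Z̃_{i,k}(0)| ≤ η_m` for `k ∈ {-1,0,1}`, and (b) the bootstrap
regime `GoodAt` on `[0, T]`, `T ≤ 100` (which bounds every coefficient of the rows (6.Z1)–(6.Z3) at
the live scales by `2`), through the channel Grönwall lemmas of `SplitCascadeRescaledChannels.lean`:
`|Z̃_{i,k}(t)| ≤ windowLevel ε₀ K ε C₁ n₀ η_m`, an explicit `gronwallBound` expression, `n₀`-small when
`η_m` and `C₁(1+ε₀)^{-n₀/2}` are (`asymWindow_of_goodAt`). The master smallness of `AsymWindow` is then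
a condition on `(η_m, n₀)` alone, to be met by the choice of the profile at assembly.

## References

* T. Tao, arXiv:1402.0290v3, §5.5, §6.5. [`Tao2016AveragedNS`]
* E. Hairer, S. P. Nørsett, G. Wanner, *Solving Ordinary Differential Equations I*, §I.10.
  [`HairerNorsettWanner1993`]
-/

noncomputable section

open Set MeasureTheory intervalIntegral Filter Topology Real

namespace Literature.Analysis.FluidPDE

namespace Tao2016AveragedNS

open TaoCascade

/-! ## Monotonicity of Mathlib's `gronwallBound` -/

/-- `gronwallBound δ K ε x = δe^{Kx} + (ε/K)(e^{Kx} - 1)` is monotone in `δ`, `ε` and `x ≥ 0` for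
`K > 0`, `ε' ≥ 0`, `δ' ≥ 0`. [cite: HairerNorsettWanner1993, §I.10] -/
theorem gronwallBound_mono {δ δ' Kr εr εr' x x' : ℝ} (hK : 0 < Kr) (hδ : δ ≤ δ') (hδ' : 0 ≤ δ')
    (hε : εr ≤ εr') (hε' : 0 ≤ εr') (hx0 : 0 ≤ x) (hx : x ≤ x') :
    gronwallBound δ Kr εr x ≤ gronwallBound δ' Kr εr' x' := by
  rw [gronwallBound_of_K_ne_0 hK.ne', gronwallBound_of_K_ne_0 hK.ne']
  have h1 : exp (Kr * x) ≤ exp (Kr * x') := exp_le_exp.2 (mul_le_mul_of_nonneg_left hx hK.le)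
  have h2 : 0 < exp (Kr * x) := exp_pos _
  have h3 : 1 ≤ exp (Kr * x) := one_le_exp (mul_nonneg hK.le hx0)
  have h4 : εr / Kr ≤ εr' / Kr := div_le_div_of_nonneg_right hε hK.le
  have h5 : 0 ≤ εr' / Kr := div_nonneg hε' hK.le
  have a1 : δ * exp (Kr * x) ≤ δ' * exp (Kr * x) := mul_le_mul_of_nonneg_right hδ h2.le
  have a2 : δ' * exp (Kr * x) ≤ δ' * exp (Kr * x') := mul_le_mul_of_nonneg_left h1 hδ'
  have a3 : εr / Kr * (exp (Kr * x) - 1) ≤ εr' / Kr * (exp (Kr * x) - 1) :=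
    mul_le_mul_of_nonneg_right h4 (by linarith)
  have a4 : εr' / Kr * (exp (Kr * x) - 1) ≤ εr' / Kr * (exp (Kr * x') - 1) :=
    mul_le_mul_of_nonneg_left (by linarith) h5
  linarith

/-- `0 ≤ gronwallBound δ K ε x` for `δ, ε, x ≥ 0`, `K > 0`. [cite: HairerNorsettWanner1993, §I.10] -/
theorem gronwallBound_nonneg' {δ Kr εr x : ℝ} (hK : 0 < Kr) (hδ : 0 ≤ δ) (hε : 0 ≤ εr)
    (hx : 0 ≤ x) : 0 ≤ gronwallBound δ Kr εr x := by
  have := gronwallBound_mono hK le_rfl hδ le_rfl hε le_rfl hx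
  rw [gronwallBound_x0] at this
  exact hδ.trans this

/-! ## The window levels -/

/-- The `c`-channel window level: `gronwallBound η² (24ε⁻¹K¹⁰ + 1) (8C₁(1+ε₀)^{-n₀/2})² 100`.
[cite: Tao2016AveragedNS, §5.5 (5.5), §6.5] -/
def windowLevelC (ε₀ K ε C₁ : ℝ) (n₀ : ℤ) (ηm : ℝ) : ℝ :=
  gronwallBound (ηm ^ 2) (24 * (ε⁻¹ * K ^ 10) + 1) ((8 * C₁ * (1 + ε₀) ^ (-(n₀ : ℝ) / 2)) ^ 2) 100

/-- The `(a,d)`-channel window level: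
`gronwallBound (2η²) (2(12ε + 12ε² + 72K) + 1) (2(8C₁(1+ε₀)^{-n₀/2} + 12ε⁻²√L_c)²) 100`.
[cite: Tao2016AveragedNS, §5.5, §6.5] -/
def windowLevelAD (ε₀ K ε C₁ : ℝ) (n₀ : ℤ) (ηm : ℝ) : ℝ :=
  gronwallBound (2 * ηm ^ 2) (2 * (12 * ε + 12 * ε ^ 2 + 72 * K) + 1)
    (2 * (8 * C₁ * (1 + ε₀) ^ (-(n₀ : ℝ) / 2) +
      12 * (ε ^ 2)⁻¹ * Real.sqrt (windowLevelC ε₀ K ε C₁ n₀ ηm)) ^ 2) 100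

/-- **The window level** `ζ(ε₀,K,ε,C₁,n₀,η) = √L_c + √L_{ad}`: the bound on the live asymmetries
`|Z̃_{i,k}(t)|`, `k ∈ {-1,0,1}`, `t ∈ [0,T]`, in terms of the profile level `η` at the checkpoint.
[cite: Tao2016AveragedNS, §5.5, §6.5] -/
def windowLevel (ε₀ K ε C₁ : ℝ) (n₀ : ℤ) (ηm : ℝ) : ℝ :=
  Real.sqrt (windowLevelC ε₀ K ε C₁ n₀ ηm) + Real.sqrt (windowLevelAD ε₀ K ε C₁ n₀ ηm)

/-- `0 ≤ windowLevel`. [cite: Tao2016AveragedNS, §6.5] -/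
theorem windowLevel_nonneg (ε₀ K ε C₁ : ℝ) (n₀ : ℤ) (ηm : ℝ) :
    0 ≤ windowLevel ε₀ K ε C₁ n₀ ηm :=
  add_nonneg (Real.sqrt_nonneg _) (Real.sqrt_nonneg _)

/-! ## The certificate -/

section Cert

variable {γ ε₀ K ε C₁ C₂ C₃ : ℝ} {n₀ N : ℤ} {ηp : ℤ → ℝ} {βp : ℕ → ℝ} {τ : ℤ → ℝ}
  {Y : Fin 4 → ℤ → ℝ → ℝ} {W : Fin 3 → ℤ → ℝ → ℝ} {F : ℤ → ℝ → ℝ}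

/-- In the bootstrap regime every live energy is at most `2`: `Ẽ_k(t) ≤ 2` for `k ∈ {-1,0,1,2}`
(`GoodAt`: `Ẽ₋₁ ≤ K⁻¹⁰(1+ε₀)^{1/5}`, `Ẽ₀ + Ẽ₁ ≤ 1`, `Ẽ₂ ≤ K⁻³⁰(1+ε₀)^{-10}`), for `K ≥ 1`, `0 < ε₀ < 1`.
[cite: Tao2016AveragedNS, §6.5 (6.92)–(6.95)] -/
theorem energy_le_two_of_goodAt (h : RescaledSplitHypotheses γ ε₀ K ε C₁ C₂ C₃ n₀ N ηp βp τ Y W F)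
    (hε₀ : 0 < ε₀) (hε₀1 : ε₀ < 1) (hK : 1 ≤ K) {t : ℝ} (ht : τ (n₀ - N) ≤ t)
    (hg : GoodAt ε₀ K Y F t) {k : ℤ} (hk : k = -1 ∨ k = 0 ∨ k = 1 ∨ k = 2) : F k t ≤ 2 := by
  have h0 : (0 : ℝ) < 1 + ε₀ := by linarith
  have hF0 := h.nonneg_F 0 t ht
  have hF1 := h.nonneg_F 1 t ht
  have hK10 : (K ^ 10)⁻¹ ≤ 1 := inv_le_one_of_one_le₀ (one_le_pow₀ hK)
  have hK30 : (K ^ 30)⁻¹ ≤ 1 := inv_le_one_of_one_le₀ (one_le_pow₀ hK)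
  rcases hk with rfl | rfl | rfl | rfl
  · have hb := hg.before 2 le_rfl
    have e : (1 : ℤ) - ((2 : ℕ) : ℤ) = -1 := by norm_num
    rw [e] at hb
    have hq : (1 + ε₀) ^ (((2 : ℕ) : ℝ) / 10) ≤ 2 := by
      calc (1 + ε₀) ^ (((2 : ℕ) : ℝ) / 10) ≤ (1 + ε₀) ^ (1 : ℝ) :=
            Real.rpow_le_rpow_of_exponent_le (by linarith) (by norm_num)
        _ ≤ 2 := by rw [Real.rpow_one]; linarith
    have hq0 : 0 ≤ (1 + ε₀) ^ (((2 : ℕ) : ℝ) / 10) := Real.rpow_nonneg h0.le _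
    calc F (-1) t ≤ (K ^ 10)⁻¹ * (1 + ε₀) ^ (((2 : ℕ) : ℝ) / 10) := hb
      _ ≤ 1 * 2 := mul_le_mul hK10 hq hq0 zero_le_one
      _ = 2 := one_mul _
  · linarith [hg.during]
  · linarith [hg.during]
  · have ha := hg.after 1 le_rfl
    have e : (1 : ℤ) + ((1 : ℕ) : ℤ) = 2 := by norm_num
    rw [e] at ha
    have hq : (1 + ε₀) ^ (-(10 : ℝ) * ((1 : ℕ) : ℝ)) ≤ 1 :=
      Real.rpow_le_one_of_one_le_of_nonpos (by linarith) (by norm_num)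
    have hq0 : 0 ≤ (1 + ε₀) ^ (-(10 : ℝ) * ((1 : ℕ) : ℝ)) := Real.rpow_nonneg h0.le _
    calc F 2 t ≤ (K ^ 30)⁻¹ * (1 + ε₀) ^ (-(10 : ℝ) * ((1 : ℕ) : ℝ)) := ha
      _ ≤ 1 * 1 := mul_le_mul hK30 hq hq0 zero_le_one
      _ ≤ 2 := by norm_num

/-- **The window certificate from the profile and the bootstrap regime.** If `GoodAt` holds on
`[0, T]`, `T ≤ 100`, and the live asymmetries are at most `η` at the checkpoint `t = 0`
(`|Z̃_{i,k}(0)| ≤ η`, `k ∈ {-1,0,1}`), then `|Z̃_{i,k}(t)| ≤ windowLevel ε₀ K ε C₁ n₀ η` on `[0, T]` for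
`k ∈ {-1,0,1}`. (Channel Grönwall at each live scale with the uniform levels: modes `≤ 2`, clock
`≥ -2`, rates `Λ_k ≤ 6`, source `≤ 8C₁(1+ε₀)^{-n₀/2}`.) [cite: Tao2016AveragedNS, §5.5, §6.5] -/
theorem RescaledSplitHypotheses.absW_le_windowLevel
    (h : RescaledSplitHypotheses γ ε₀ K ε C₁ C₂ C₃ n₀ N ηp βp τ Y W F) (hε₀ : 0 < ε₀) (hε₀1 : ε₀ < 1)
    (hε : 0 < ε) (hK : 1 ≤ K) (hC₁ : 0 ≤ C₁) (hτ0 : τ (n₀ - N) ≤ 0) {T ηm : ℝ}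
    (hT : T ≤ 100) (hgood : ∀ t ∈ Icc 0 T, GoodAt ε₀ K Y F t)
    (hη : ∀ i : Fin 3, |W i (-1) 0| ≤ ηm ∧ |W i 0 0| ≤ ηm ∧ |W i 1 0| ≤ ηm)
    {t : ℝ} (ht : t ∈ Icc 0 T) (i : Fin 3) {k : ℤ} (hk : k = -1 ∨ k = 0 ∨ k = 1) :
    |W i k t| ≤ windowLevel ε₀ K ε C₁ n₀ ηm := by
  have h0 : (0 : ℝ) < 1 + ε₀ := by linarith
  have hK0 : 0 < K := by linarith
  have hT0 : 0 ≤ T := ht.1.trans ht.2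
  set δ : ℝ := (1 + ε₀) ^ (-(n₀ : ℝ) / 2) with hδ
  have hδ0 : 0 < δ := Real.rpow_pos_of_pos h0 _
  set Λk : ℝ := (1 + ε₀) ^ ((5 : ℝ) * k / 2) with hΛk
  have hΛk0 : 0 < Λk := Real.rpow_pos_of_pos h0 _
  have hk1 : (k : ℝ) ≤ 1 := by rcases hk with rfl | rfl | rfl <;> norm_num
  have hk1' : (-1 : ℝ) ≤ k := by rcases hk with rfl | rfl | rfl <;> norm_num
  have hΛk6 : Λk ≤ 6 := by
    calc Λk ≤ (1 + ε₀) ^ ((5 : ℝ) / 2) :=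
          Real.rpow_le_rpow_of_exponent_le (by linarith) (by nlinarith)
      _ ≤ 6 := rpow_five_halves_le_six h0.le (by linarith)
  -- energies `≤ 2` and modes `≤ 2` on `[0, T]` at the live scales and at `k + 1`
  have hkm : k = -1 ∨ k = 0 ∨ k = 1 ∨ k = 2 := by rcases hk with h1 | h1 | h1 <;> simp [h1]
  have hkm' : k + 1 = -1 ∨ k + 1 = 0 ∨ k + 1 = 1 ∨ k + 1 = 2 := by
    rcases hk with rfl | rfl | rfl <;> norm_num
  have hEk : ∀ s ∈ Icc 0 T, F k s ≤ 2 := fun s hs =>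
    energy_le_two_of_goodAt h hε₀ hε₀1 hK (hτ0.trans hs.1) (hgood s hs) hkm
  have hEk1 : ∀ s ∈ Icc 0 T, F (k + 1) s ≤ 2 := fun s hs =>
    energy_le_two_of_goodAt h hε₀ hε₀1 hK (hτ0.trans hs.1) (hgood s hs) hkm'
  have hY : ∀ s ∈ Icc 0 T, ∀ j : Fin 4, |Y j k s| ≤ 2 := fun s hs j =>
    h.abs_le_of_energy_le j k (hτ0.trans hs.1) (by norm_num) (by linarith [hEk s hs])
  have hY1 : ∀ s ∈ Icc 0 T, |Y 0 (k + 1) s| ≤ 2 := fun s hs =>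
    h.abs_le_of_energy_le 0 (k + 1) (hτ0.trans hs.1) (by norm_num) (by linarith [hEk1 s hs])
  -- the source level `σ = 8 C₁ δ`
  have hsplit : (1 + ε₀) ^ ((2 : ℝ) * k - n₀ / 2) = (1 + ε₀) ^ ((2 : ℝ) * k) * δ := by
    rw [hδ, ← Real.rpow_add h0]; congr 1; ring
  have hΛ2 : (1 + ε₀) ^ ((2 : ℝ) * k) ≤ 4 := by
    calc (1 + ε₀) ^ ((2 : ℝ) * k) ≤ (1 + ε₀) ^ (2 : ℝ) :=
          Real.rpow_le_rpow_of_exponent_le (by linarith) (by nlinarith)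
      _ ≤ 2 ^ (2 : ℝ) := Real.rpow_le_rpow h0.le (by linarith) (by norm_num)
      _ = 4 := by norm_num
  have hσ : ∀ s ∈ Ico 0 T, C₁ * (1 + ε₀) ^ ((2 : ℝ) * k - n₀ / 2) * Real.sqrt (F k s) ≤ 8 * C₁ * δ := by
    intro s hs
    have hsq : Real.sqrt (F k s) ≤ 2 := by
      have := hEk s (Ico_subset_Icc_self hs)
      calc Real.sqrt (F k s) ≤ Real.sqrt 4 := Real.sqrt_le_sqrt (by linarith)
        _ = 2 := by rw [show (4 : ℝ) = 2 ^ 2 by norm_num, Real.sqrt_sq (by norm_num)]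
    rw [hsplit]
    have hq0 : 0 ≤ (1 + ε₀) ^ ((2 : ℝ) * k) := Real.rpow_nonneg h0.le _
    calc C₁ * ((1 + ε₀) ^ ((2 : ℝ) * k) * δ) * Real.sqrt (F k s)
        = C₁ * δ * ((1 + ε₀) ^ ((2 : ℝ) * k) * Real.sqrt (F k s)) := by ring
      _ ≤ C₁ * δ * (4 * 2) := by
          apply mul_le_mul_of_nonneg_left _ (mul_nonneg hC₁ hδ0.le)
          exact mul_le_mul hΛ2 hsq (Real.sqrt_nonneg _) (by norm_num)
      _ = 8 * C₁ * δ := by ring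
  -- the clock lower bound `b̃_k ≥ -2 = -(12/Λ_k)·(Λ_k/6)`; we use `β₀ = 12/Λ_k ≥ 2`
  have hb : ∀ s ∈ Ico 0 T, -(12 / Λk) ≤ Y 1 k s := by
    intro s hs
    have h1 := (abs_le.mp (hY s (Ico_subset_Icc_self hs) 1)).1
    have h2 : 2 ≤ 12 / Λk := by rw [le_div_iff₀ hΛk0]; linarith
    linarith
  -- (A) the `c`-channel
  have hLc : ∀ s ∈ Icc 0 T, W 1 k s ^ 2 ≤ windowLevelC ε₀ K ε C₁ n₀ ηm := by
    intro s hs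
    have hc := h.asymW_c_sq_le_gronwallBound (by linarith) hε (k := k) (t₁ := 0) (t₂ := T)
      (β₀ := 12 / Λk) (σ := 8 * C₁ * δ) (lam := 1) hτ0 one_pos hb hσ hs
    have hrate : 2 * ((1 + ε₀) ^ ((5 : ℝ) * k / 2) * (ε⁻¹ * K ^ 10)) * (12 / Λk) + 1 =
        24 * (ε⁻¹ * K ^ 10) + 1 := by
      rw [← hΛk]; field_simp; ring
    rw [hrate, sub_zero, div_one] at hc
    refine hc.trans ?_
    unfold windowLevelC
    have hW0 : W 1 k 0 ^ 2 ≤ ηm ^ 2 := by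
      have hw0 : |W 1 k 0| ≤ ηm := by
        rcases hk with rfl | rfl | rfl
        · exact (hη 1).1
        · exact (hη 1).2.1
        · exact (hη 1).2.2
      rw [← sq_abs]; exact pow_le_pow_left₀ (abs_nonneg _) hw0 2
    exact gronwallBound_mono (by positivity) hW0 (sq_nonneg _) le_rfl (sq_nonneg _) hs.1
      (hs.2.trans hT)
  have hLc0 : 0 ≤ windowLevelC ε₀ K ε C₁ n₀ ηm := (sq_nonneg _).trans (hLc 0 ⟨le_rfl, hT0⟩)
  set ηc : ℝ := Real.sqrt (windowLevelC ε₀ K ε C₁ n₀ ηm) with hηc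
  have hWc : ∀ s ∈ Icc 0 T, |W 1 k s| ≤ ηc := fun s hs => by
    rw [hηc, ← Real.sqrt_sq_eq_abs]; exact Real.sqrt_le_sqrt (hLc s hs)
  -- (P)+(H) the `(a,d)`-channel
  set M : ℝ := 12 * ε + 12 * ε ^ 2 + 72 * K with hM
  have hM0 : ∀ s ∈ Ico 0 T, (1 + ε₀) ^ ((5 : ℝ) * k / 2) *
      (ε * Y 1 k s + ε ^ 2 * Real.exp (-K ^ 10) * Y 2 k s) ≤ M := by
    intro s hs
    have hb' := abs_le.mp (hY s (Ico_subset_Icc_self hs) 1)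
    have hc' := abs_le.mp (hY s (Ico_subset_Icc_self hs) 2)
    have hE1 : Real.exp (-K ^ 10) ≤ 1 := Real.exp_le_one_iff.mpr (by
      have : 0 ≤ K ^ 10 := by positivity
      linarith)
    have hE0 : 0 < Real.exp (-K ^ 10) := Real.exp_pos _
    rw [← hΛk]
    have hin : ε * Y 1 k s + ε ^ 2 * Real.exp (-K ^ 10) * Y 2 k s ≤ 2 * ε + 2 * ε ^ 2 := by
      have a1 : ε * Y 1 k s ≤ ε * 2 := mul_le_mul_of_nonneg_left hb'.2 hε.le
      have a2 : ε ^ 2 * Real.exp (-K ^ 10) * Y 2 k s ≤ ε ^ 2 * Real.exp (-K ^ 10) * 2 :=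
        mul_le_mul_of_nonneg_left hc'.2 (by positivity)
      have a3 : ε ^ 2 * Real.exp (-K ^ 10) * 2 ≤ ε ^ 2 * 1 * 2 := by
        apply mul_le_mul_of_nonneg_right _ (by norm_num)
        exact mul_le_mul_of_nonneg_left hE1 (sq_nonneg _)
      linarith
    rcases le_or_gt 0 (ε * Y 1 k s + ε ^ 2 * Real.exp (-K ^ 10) * Y 2 k s) with hpos | hneg
    · calc Λk * (ε * Y 1 k s + ε ^ 2 * Real.exp (-K ^ 10) * Y 2 k s) ≤ 6 * (2 * ε + 2 * ε ^ 2) :=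
            mul_le_mul hΛk6 hin hpos (by norm_num)
        _ ≤ M := by rw [hM]; nlinarith [hK0]
    · have : Λk * (ε * Y 1 k s + ε ^ 2 * Real.exp (-K ^ 10) * Y 2 k s) ≤ 0 :=
        mul_nonpos_of_nonneg_of_nonpos hΛk0.le hneg.le
      have hMpos : 0 ≤ M := by rw [hM]; positivity
      linarith
  have hM2 : ∀ s ∈ Ico 0 T, (1 + ε₀) ^ ((5 : ℝ) * k / 2) *
      ((1 + ε₀) ^ ((5 : ℝ) / 2) * K * Y 0 (k + 1) s) ≤ M := by
    intro s hs
    have ha' := abs_le.mp (hY1 s (Ico_subset_Icc_self hs))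
    have hq6 : (1 + ε₀) ^ ((5 : ℝ) / 2) ≤ 6 := rpow_five_halves_le_six h0.le (by linarith)
    have hq0 : 0 ≤ (1 + ε₀) ^ ((5 : ℝ) / 2) := Real.rpow_nonneg h0.le _
    rw [← hΛk]
    rcases le_or_gt 0 (Y 0 (k + 1) s) with hpos | hneg
    · calc Λk * ((1 + ε₀) ^ ((5 : ℝ) / 2) * K * Y 0 (k + 1) s) ≤ 6 * (6 * K * 2) := by
            apply mul_le_mul hΛk6 _ (by positivity) (by norm_num)
            exact mul_le_mul (mul_le_mul_of_nonneg_right hq6 hK0.le) ha'.2 hpos (by positivity)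
        _ ≤ M := by rw [hM]; nlinarith [hε.le, sq_nonneg ε]
    · have : Λk * ((1 + ε₀) ^ ((5 : ℝ) / 2) * K * Y 0 (k + 1) s) ≤ 0 :=
        mul_nonpos_of_nonneg_of_nonpos hΛk0.le
          (mul_nonpos_of_nonneg_of_nonpos (by positivity) hneg.le)
      have hMpos : 0 ≤ M := by rw [hM]; positivity
      linarith
  have hRa : ∀ s ∈ Ico 0 T, |Y 0 k s| ≤ 2 := fun s hs => hY s (Ico_subset_Icc_self hs) 0
  have hRd : ∀ s ∈ Ico 0 T, |Y 3 k s| ≤ 2 := fun s hs => hY s (Ico_subset_Icc_self hs) 3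
  have hcI : ∀ s ∈ Ico 0 T, |W 1 k s| ≤ ηc := fun s hs => hWc s (Ico_subset_Icc_self hs)
  have hLad : W 0 k t ^ 2 + W 2 k t ^ 2 ≤ windowLevelAD ε₀ K ε C₁ n₀ ηm := by
    have had := h.asymW_ad_sq_le_gronwallBound (by linarith) hε (k := k) (t₁ := 0) (t₂ := T)
      (M := M) (R := 2) (ηc := ηc) (σ := 8 * C₁ * δ) (lam := 1) hτ0 one_pos (by norm_num)
      hM0 hM2 hRa hRd hcI hσ ht
    rw [sub_zero, div_one] at had
    refine had.trans ?_
    unfold windowLevelAD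
    have hW0 : W 0 k 0 ^ 2 + W 2 k 0 ^ 2 ≤ 2 * ηm ^ 2 := by
      have hw0 : |W 0 k 0| ≤ ηm ∧ |W 2 k 0| ≤ ηm := by
        rcases hk with rfl | rfl | rfl
        · exact ⟨(hη 0).1, (hη 2).1⟩
        · exact ⟨(hη 0).2.1, (hη 2).2.1⟩
        · exact ⟨(hη 0).2.2, (hη 2).2.2⟩
      have a1 : W 0 k 0 ^ 2 ≤ ηm ^ 2 := by
        rw [← sq_abs]; exact pow_le_pow_left₀ (abs_nonneg _) hw0.1 2
      have a2 : W 2 k 0 ^ 2 ≤ ηm ^ 2 := by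
        rw [← sq_abs]; exact pow_le_pow_left₀ (abs_nonneg _) hw0.2 2
      linarith
    have hηc0 : 0 ≤ ηc := Real.sqrt_nonneg _
    have hG : (8 * C₁ * δ + (1 + ε₀) ^ ((5 : ℝ) * k / 2) * (ε ^ 2)⁻¹ * 2 * ηc) ^ 2 ≤
        (8 * C₁ * (1 + ε₀) ^ (-(n₀ : ℝ) / 2) + 12 * (ε ^ 2)⁻¹ *
          Real.sqrt (windowLevelC ε₀ K ε C₁ n₀ ηm)) ^ 2 := by
      rw [← hδ, ← hΛk, ← hηc]
      have hin : Λk * (ε ^ 2)⁻¹ * 2 * ηc ≤ 12 * (ε ^ 2)⁻¹ * ηc := by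
        have : 0 ≤ (ε ^ 2)⁻¹ * ηc := by positivity
        nlinarith
      have hl0 : 0 ≤ 8 * C₁ * δ + Λk * (ε ^ 2)⁻¹ * 2 * ηc := by positivity
      exact pow_le_pow_left₀ hl0 (by linarith) 2
    have hMK : 0 < 2 * M + 1 := by rw [hM]; positivity
    exact gronwallBound_mono hMK hW0 (by positivity)
      (by linarith [mul_le_mul_of_nonneg_left hG (by norm_num : (0 : ℝ) ≤ 2)]) (by positivity)
      ht.1 (ht.2.trans hT)
  -- conclusion
  have hLad0 : 0 ≤ windowLevelAD ε₀ K ε C₁ n₀ ηm := le_trans (by positivity) hLad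
  unfold windowLevel
  have hc_fin : |W 1 k t| ≤ Real.sqrt (windowLevelC ε₀ K ε C₁ n₀ ηm) := hWc t ht
  have ha_fin : |W 0 k t| ≤ Real.sqrt (windowLevelAD ε₀ K ε C₁ n₀ ηm) := by
    rw [← Real.sqrt_sq_eq_abs]; exact Real.sqrt_le_sqrt (by nlinarith [sq_nonneg (W 2 k t)])
  have hd_fin : |W 2 k t| ≤ Real.sqrt (windowLevelAD ε₀ K ε C₁ n₀ ηm) := by
    rw [← Real.sqrt_sq_eq_abs]; exact Real.sqrt_le_sqrt (by nlinarith [sq_nonneg (W 0 k t)])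
  have hs1 : 0 ≤ Real.sqrt (windowLevelC ε₀ K ε C₁ n₀ ηm) := Real.sqrt_nonneg _
  have hs2 : 0 ≤ Real.sqrt (windowLevelAD ε₀ K ε C₁ n₀ ηm) := Real.sqrt_nonneg _
  fin_cases i
  · simp only [Fin.zero_eta]; linarith
  · simp only [Fin.mk_one]; linarith
  · show |W 2 k t| ≤ _
    linarith

/-- **The window certificate `AsymWindow`** from the profile, the bootstrap regime and the master
smallness of the level (a condition on `(η, n₀)` only).
[cite: Tao2016AveragedNS, §5.5, §6.5] -/
theorem RescaledSplitHypotheses.asymWindow_of_goodAt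
    (h : RescaledSplitHypotheses γ ε₀ K ε C₁ C₂ C₃ n₀ N ηp βp τ Y W F) (hε₀ : 0 < ε₀) (hε₀1 : ε₀ < 1)
    (hε : 0 < ε) (hK : 1 ≤ K) (hC₁ : 0 ≤ C₁) (hτ0 : τ (n₀ - N) ≤ 0) {T ηm : ℝ}
    (hT : T ≤ 100) (hgood : ∀ t ∈ Icc 0 T, GoodAt ε₀ K Y F t)
    (hη : ∀ i : Fin 3, |W i (-1) 0| ≤ ηm ∧ |W i 0 0| ≤ ηm ∧ |W i 1 0| ≤ ηm)
    (hsmall : 16 * (K ^ 5 * (1 + ε₀) ^ (2 : ℝ)) * ((ε ^ 2)⁻¹ + ε⁻¹ * K ^ 10 + K + 1) *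
      windowLevel ε₀ K ε C₁ n₀ ηm ^ 2 ≤ C₁ / 2 * (1 + ε₀) ^ (-(n₀ : ℝ) / 2)) :
    AsymWindow ε₀ K ε C₁ n₀ W T (windowLevel ε₀ K ε C₁ n₀ ηm) where
  asym := fun _ ht i =>
    ⟨h.absW_le_windowLevel hε₀ hε₀1 hε hK hC₁ hτ0 hT hgood hη ht i (Or.inl rfl),
      h.absW_le_windowLevel hε₀ hε₀1 hε hK hC₁ hτ0 hT hgood hη ht i (Or.inr (Or.inl rfl)),
      h.absW_le_windowLevel hε₀ hε₀1 hε hK hC₁ hτ0 hT hgood hη ht i (Or.inr (Or.inr rfl))⟩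
  small := hsmall

end Cert

end Tao2016AveragedNS

end Literature.Analysis.FluidPDE
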